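import Mathlib.Analysis.Calculus.Deriv.Polynomial
import Mathlib.Analysis.Complex.HasPrimitives
import Mathlib.Analysis.Complex.LocallyUniformLimit
import Mathlib.Analysis.SpecialFunctions.Complex.Log
import Literature.Analysis.Complex.Runge
import Literature.Topology.PlaneTopology.JordanCurve
import HarnessLib

/-!
# Polynomial approximation, primitives, logarithms and square roots on plane domains without holes

Consequences of Runge's theorem (`Literature.Analysis.Complex.Runge`) for an open set `G ⊆ ℂ`
**without holes**, i.e. such that no connected component of `ℂ \ G` is bounded (for open `G` this
is Conway's condition VIII.2.2 (c) "`ℂ∞ \ G` is connected", phrased inside `ℂ`):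

* `Complex.exists_isCompact_superset_isPreconnected_compl` (Conway VII.1.2 / Rudin 13.3 in the
  hole-free case): every compact `K ⊆ G` lies in a compact `K' ⊆ G` with `ℂ \ K'` connected;
* `Complex.exists_polynomial_norm_sub_lt_of_isOpen` (Conway VIII.1.15): holomorphic functions on
  `G` are uniformly approximable by polynomials on each compact subset of `G`;
* `Complex.isExactOn_of_polynomial_approx` (Conway VIII.2.2, (d) ⇒ (f)): on a *connected*
  open set, a function which is approximable by polynomials on compacts has a primitive
  (Mathlib's `Complex.IsExactOn f G`); `Complex.isExactOn_of_compl`: hence (c) ⇒ (f). (Conway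
  routes through (e) "`∫_γ f = 0`"; we avoid line integrals: primitives `Qₙ` of
  the approximating polynomials `Pₙ`, normalised at a base point, are locally uniformly Cauchy by
  the mean value inequality on discs (`uniformCauchySeqOn_ball_of_deriv`), the set where
  `(Qₙ(x))ₙ` converges being open and closed; the locally uniform limit `F` has `F' = lim Pₙ = f`
  by Weierstrass' theorem `TendstoLocallyUniformlyOn.deriv`.)
* `Complex.exists_eq_exp_of_forall_isExactOn` ((f) ⇒ (g)), `Complex.exists_sq_eq_of_exists_eq_exp`
  ((g) ⇒ (h)) and `Complex.exists_sq_eq_of_compl` ((c) ⇒ (h)): zero-free holomorphic functions on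
  such `G` have holomorphic logarithms and square roots; the conclusion of the last one is
  definitionally the body of `Complex.HasSqrt G` (`Literature.Analysis.Complex.RiemannMapping`),
  which is how it is consumed.

The last step of Conway VIII.2.2, (h) ⇒ (i) ⇒ (a) (via the Riemann mapping theorem in the form of
Conway's Lemma VII.4.3, `Complex.exists_bijOn_ball_of_hasSqrt`), is carried out in the planned
sequel `Literature/Analysis/Complex/SimplyConnectedOfCompl.lean` (proposed after this file).

## Mathlib

We USE `Complex.IsExactOn` (`Mathlib.Analysis.Complex.HasPrimitives`: "has a primitive on `U`";
Mathlib proves it on discs and on `ℂ` only, with a TODO for simply connected domains, which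
`isExactOn_of_compl` below settles for hole-free domains), `IsExactOn.with_val_at`,
`Differentiable.isExactOn_univ` with `Polynomial.differentiable` (primitives of polynomials),
`uniformCauchySeqOn_ball_of_deriv` (mean value inequality: uniformly Cauchy derivatives on a disc
and Cauchy at the centre ⇒ uniformly Cauchy), `TendstoLocallyUniformlyOn.differentiableOn` /
`.deriv` (Weierstrass), `Metric.thickening`, `connectedComponentIn`,
`IsPreconnected.subset_of_closure_inter_subset`, `IsOpen.is_const_of_deriv_eq_zero`, and from `Literature.Topology.PlaneTopology.JordanCurve` the
proved lemma `Literature.Topology.PlaneTopology.isConnected_setOf_lt_norm` (the exterior of a disc is connected).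

## References

* J. B. Conway, *Functions of One Complex Variable I*, 2nd ed., GTM 11, Springer (1978),
  Prop. VII.1.2, Cor. VIII.1.15, Thm. VIII.2.2 (pp. 143, 200, 202–204).
* W. Rudin, *Real and Complex Analysis*, 3rd ed. (1987), Thm. 13.3, 13.9, 13.11.
-/

noncomputable section

open Set Filter Topology Metric Bornology Polynomial

namespace Complex

/-! ### Compact exhaustion with connected complement (Conway VII.1.2, Rudin 13.3) -/

/-- **Filling a compact set inside a hole-free open set** (Conway VII.1.2 / Rudin 13.3 in the case
where no component of `ℂ \ G` is bounded). Let `G ⊆ ℂ` be open such that every connected component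
of `ℂ \ G` is unbounded, and let `K ⊆ G` be compact. Then there is a compact `K'` with
`K ⊆ K' ⊆ G` and `ℂ \ K'` connected. Construction: `K' = B̄(0, R) \ (ℂ \ G)_r` for `B̄(0, R) ⊇ K`
and `r > 0` with `K_r ⊆ G` (the same shape, with `(R, r) = (n, 1/(n+1))`, is Conway's compact
exhaustion of `G`, used inside `isExactOn_of_polynomial_approx`); then `ℂ \ K' = {|z| > R} ∪ ⋃_{a ∉ G} B(a, r)`, and each `B(a, r)` is
joined to `{|z| > R}` inside `ℂ \ K'` by the (unbounded) component of `a` in `ℂ \ G`. Conway,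
*Functions of One Complex Variable I* (1978), Prop. VII.1.2 (c); Rudin, *Real and Complex
Analysis*, Thm. 13.3. [cite: Conway1978, Ch. VII Prop. 1.2] -/
theorem exists_isCompact_superset_isPreconnected_compl {G K : Set ℂ} (hG : IsOpen G)
    (hGh : ∀ a ∈ Gᶜ, ¬ IsBounded (connectedComponentIn Gᶜ a)) (hK : IsCompact K)
    (hKG : K ⊆ G) : ∃ K' : Set ℂ, IsCompact K' ∧ K ⊆ K' ∧ K' ⊆ G ∧ IsPreconnected K'ᶜ := by
  obtain ⟨r, hr, hrG⟩ := hK.exists_cthickening_subset_open hG hKG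
  obtain ⟨R₀, hR₀⟩ := hK.isBounded.subset_closedBall 0
  set R : ℝ := max R₀ 0 with hRdef
  have hR : K ⊆ closedBall 0 R := hR₀.trans (closedBall_subset_closedBall (le_max_left _ _))
  set U : Set ℂ := (closedBall (0 : ℂ) R)ᶜ with hU
  have hU' : U = {z : ℂ | R < ‖z‖} := by
    ext z
    simp [hU, not_le]
  have hUc : IsPreconnected U := hU' ▸ (Literature.Topology.PlaneTopology.isConnected_setOf_lt_norm (le_max_right R₀ 0)).isPreconnected
  obtain ⟨x₀, hx₀⟩ : U.Nonempty := hU' ▸ (Literature.Topology.PlaneTopology.isConnected_setOf_lt_norm (le_max_right R₀ 0)).nonempty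
  refine ⟨closedBall 0 R ∩ (thickening r Gᶜ)ᶜ, ?_, ?_, ?_, ?_⟩
  · exact (isCompact_closedBall 0 R).inter_right isOpen_thickening.isClosed_compl
  · refine subset_inter hR fun z hz hzt ↦ ?_
    obtain ⟨a, ha, hza⟩ := mem_thickening_iff.1 hzt
    exact ha (hrG (mem_cthickening_of_dist_le a z r K hz (by rw [dist_comm]; exact hza.le)))
  · rintro z ⟨-, hz⟩
    by_contra hzG
    exact hz (self_subset_thickening hr Gᶜ hzG)
  · -- `ℂ \ K' = U ∪ ⋃_{a ∉ G} B(a, r)`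
    rw [compl_inter, compl_compl]
    set T : ℂ → Set ℂ := fun a ↦
      U ∪ (ball a r ∪ connectedComponentIn Gᶜ a) ∩ {_z | a ∈ Gᶜ} with hT
    have hTc : ∀ a, IsPreconnected (T a) := by
      intro a
      by_cases ha : a ∈ Gᶜ
      · have h1 : IsPreconnected (ball a r ∪ connectedComponentIn Gᶜ a) :=
          IsPreconnected.union a (mem_ball_self hr) (mem_connectedComponentIn ha)
            (convex_ball a r).isPreconnected isPreconnected_connectedComponentIn
        have h2 : (U ∩ (ball a r ∪ connectedComponentIn Gᶜ a)).Nonempty := by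
          by_contra h
          rw [not_nonempty_iff_eq_empty] at h
          refine hGh a ha ((isBounded_closedBall (x := (0 : ℂ)) (r := R)).subset fun z hz ↦ ?_)
          by_contra hzR
          have : z ∈ U ∩ (ball a r ∪ connectedComponentIn Gᶜ a) := ⟨hzR, Or.inr hz⟩
          rw [h] at this
          exact this
        have hT' : T a = U ∪ (ball a r ∪ connectedComponentIn Gᶜ a) := by
          simp only [hT]
          rw [show ({_z | a ∈ Gᶜ} : Set ℂ) = univ from eq_univ_of_forall fun _ ↦ ha, inter_univ]
        rw [hT']
        exact hUc.union' h2 h1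
      · have hT' : T a = U := by
          simp only [hT]
          rw [show ({_z | a ∈ Gᶜ} : Set ℂ) = ∅ from eq_empty_of_forall_notMem fun _ h ↦ ha h,
            inter_empty, union_empty]
        rw [hT']
        exact hUc
    have hx₀T : ∀ a, x₀ ∈ T a := fun a ↦ Or.inl hx₀
    have key : IsPreconnected (⋃ a, T a) := isPreconnected_iUnion ⟨x₀, mem_iInter.2 hx₀T⟩ hTc
    convert key using 1
    apply subset_antisymm
    · rintro z (hz | hz)
      · exact mem_iUnion.2 ⟨x₀, Or.inl hz⟩
      · obtain ⟨a, ha, hza⟩ := mem_thickening_iff.1 hz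
        exact mem_iUnion.2 ⟨a, Or.inr ⟨Or.inl hza, ha⟩⟩
    · refine iUnion_subset fun a ↦ union_subset subset_union_left ?_
      rintro z ⟨hz | hz, ha⟩
      · exact Or.inr (ball_subset_thickening (show a ∈ Gᶜ from ha) r hz)
      · exact Or.inr (self_subset_thickening hr Gᶜ (connectedComponentIn_subset _ _ hz))

/-! ### Runge's theorem on hole-free open sets (Conway VIII.1.15) -/

/-- **Runge's theorem for open sets without holes** (Conway VIII.1.15): if `G ⊆ ℂ` is open and no
component of `ℂ \ G` is bounded, then every `f` holomorphic on `G` can be approximated uniformly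
by polynomials on each compact `K ⊆ G`. Conway, *Functions of One Complex Variable I* (1978),
Ch. VIII Cor. 1.15 (with Prop. VII.1.2). [cite: Conway1978, Ch. VIII Cor. 1.15] -/
theorem exists_polynomial_norm_sub_lt_of_isOpen {G K : Set ℂ} (hG : IsOpen G)
    (hGh : ∀ a ∈ Gᶜ, ¬ IsBounded (connectedComponentIn Gᶜ a)) (hK : IsCompact K) (hKG : K ⊆ G)
    {f : ℂ → ℂ} (hf : DifferentiableOn ℂ f G) {ε : ℝ} (hε : 0 < ε) :
    ∃ p : ℂ[X], ∀ z ∈ K, ‖f z - p.eval z‖ < ε := by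
  obtain ⟨K', hK', hKK', hK'G, hK'c⟩ :=
    exists_isCompact_superset_isPreconnected_compl hG hGh hK hKG
  obtain ⟨p, hp⟩ := exists_polynomial_norm_sub_lt hG hK' hK'G hK'c hf hε
  exact ⟨p, fun z hz ↦ hp z (hKK' hz)⟩

/-! ### Primitives (Conway VIII.2.2, (d) ⇒ (f)) -/

/-- **Primitives from polynomial approximation** (Conway VIII.2.2, (d) ⇒ (f)). Let `G ⊆ ℂ` be
open and connected and let `f : G → ℂ` be uniformly approximable by polynomials on every compact
subset of `G`. Then `f` has a holomorphic primitive on `G`. Proof (avoiding line integrals): with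
polynomials `Pₙ → f` locally uniformly and `Qₙ` a primitive of `Pₙ` vanishing at a base point
`z₀ ∈ G` (`Differentiable.isExactOn_univ`), the set of `x ∈ G` at which `(Qₙ(x))ₙ` converges is
open and closed in `G` (on discs where `(Pₙ)` is uniformly Cauchy, `(Qₙ)` is uniformly Cauchy as
soon as it is Cauchy at the centre, Mathlib's `uniformCauchySeqOn_ball_of_deriv`), hence all of
`G`; the convergence is locally uniform, so the limit `F` is holomorphic with
`F' = lim Qₙ' = lim Pₙ = f` (`TendstoLocallyUniformlyOn.deriv`).
Conway, *Functions of One Complex Variable I* (1978), Thm. VIII.2.2 ((d) ⇒ (e) ⇒ (f)). [cite: Conway1978, Ch. VIII Thm. 2.2 ((d)⇒(f))] -/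
theorem isExactOn_of_polynomial_approx {G : Set ℂ} (hG : IsOpen G) (hGc : IsPreconnected G)
    {f : ℂ → ℂ}
    (happrox : ∀ K ⊆ G, IsCompact K → ∀ ε > (0 : ℝ), ∃ p : ℂ[X], ∀ z ∈ K, ‖f z - p.eval z‖ < ε) :
    IsExactOn f G := by
  rcases G.eq_empty_or_nonempty with rfl | ⟨z₀, hz₀⟩
  · exact ⟨0, fun z hz ↦ hz.elim⟩
  -- a compact exhaustion `K n = B̄(0, n) ∖ (ℂ ∖ G)_{1/(n+1)}` of `G` (Conway VII.1.2)
  set K : ℕ → Set ℂ := fun n ↦ closedBall 0 n ∩ (thickening (1 / ((n : ℝ) + 1)) Gᶜ)ᶜ with hKdef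
  have hKc : ∀ n, IsCompact (K n) := fun n ↦
    (isCompact_closedBall 0 _).inter_right isOpen_thickening.isClosed_compl
  have hKG : ∀ n, K n ⊆ G := by
    rintro n z ⟨-, hz⟩
    by_contra hzG
    exact hz (self_subset_thickening (by positivity) Gᶜ hzG)
  have hKev : ∀ L, IsCompact L → L ⊆ G → ∀ᶠ n in atTop, L ⊆ K n := by
    intro L hL hLG
    obtain ⟨r, hr, hrG⟩ := hL.exists_cthickening_subset_open hG hLG
    obtain ⟨R, hR⟩ := hL.isBounded.subset_closedBall 0
    obtain ⟨N, hN⟩ := exists_nat_gt (max R (1 / r))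
    filter_upwards [eventually_ge_atTop N] with n hn
    have hn' : max R (1 / r) < n := hN.trans_le (by exact_mod_cast hn)
    refine subset_inter (hR.trans (closedBall_subset_closedBall (le_of_max_le_left hn'.le))) ?_
    intro z hz hzt
    obtain ⟨a, ha, hza⟩ := mem_thickening_iff.1 hzt
    have h1 : 1 / ((n : ℝ) + 1) ≤ r := by
      have : 1 / r < (n : ℝ) + 1 := (le_of_max_le_right hn'.le).trans_lt (by linarith)
      rw [div_le_iff₀ (by positivity)]
      rw [div_lt_iff₀ hr] at this
      linarith
    exact ha (hrG (mem_cthickening_of_dist_le a z r L hz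
      (by rw [dist_comm]; exact (hza.trans_le h1).le)))
  -- polynomials `P n → f` locally uniformly on `G`
  have hP : ∀ n : ℕ, ∃ p : ℂ[X], ∀ z ∈ K n, ‖f z - p.eval z‖ < 1 / ((n : ℝ) + 1) :=
    fun n ↦ happrox _ (hKG n) (hKc n) _ Nat.one_div_pos_of_nat
  choose p hp using hP
  set P : ℕ → ℂ → ℂ := fun n z ↦ (p n).eval z with hPdef
  have hPf : TendstoLocallyUniformlyOn P f atTop G := by
    refine (tendstoLocallyUniformlyOn_iff_forall_isCompact hG).2 fun L hLG hL ↦ ?_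
    refine Metric.tendstoUniformlyOn_iff.2 fun ε hε ↦ ?_
    obtain ⟨N, hN⟩ := exists_nat_gt (1 / ε)
    filter_upwards [hKev L hL hLG, eventually_ge_atTop N] with n hn hn'
    intro z hz
    rw [dist_eq_norm]
    refine (hp n z (hn hz)).trans ?_
    have hN' : 1 / ε < (n : ℝ) + 1 := hN.trans_le (by exact_mod_cast Nat.le_succ_of_le hn')
    rw [div_lt_iff₀ hε] at hN'
    rw [div_lt_iff₀ (by positivity)]
    linarith
  -- primitives `Q n` of the polynomials `P n` with `Q n z₀ = 0` (polynomials are entire, hence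
  -- exact on `ℂ`: `Differentiable.isExactOn_univ`)
  have hQex : ∀ n, ∃ Q : ℂ → ℂ, Q z₀ = 0 ∧ ∀ z ∈ (univ : Set ℂ), HasDerivAt Q (P n z) z :=
    fun n ↦ ((p n).differentiable.isExactOn_univ).with_val_at z₀ 0
  choose Q hQ₀ hQ' using hQex
  have hQ : ∀ n z, HasDerivAt (Q n) (P n z) z := fun n z ↦ hQ' n z (mem_univ z)
  -- discs in `G` on which `P` is uniformly Cauchy
  have hdisc : ∀ x ∈ G, ∃ ρ > 0, ball x ρ ⊆ G ∧ UniformCauchySeqOn P atTop (ball x ρ) := by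
    intro x hx
    obtain ⟨ρ, hρ, hρG⟩ := nhds_basis_closedBall.mem_iff.1 (hG.mem_nhds hx)
    refine ⟨ρ, hρ, ball_subset_closedBall.trans hρG, ?_⟩
    exact (((tendstoLocallyUniformlyOn_iff_forall_isCompact hG).1 hPf _ hρG
      (isCompact_closedBall x ρ)).mono ball_subset_closedBall).uniformCauchySeqOn
  -- on such a disc, `Q` is uniformly Cauchy as soon as it is Cauchy at the centre
  -- (`uniformCauchySeqOn_ball_of_deriv`: the mean value inequality)
  have hball : ∀ {x : ℂ} {ρ : ℝ}, UniformCauchySeqOn P atTop (ball x ρ) →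
      CauchySeq (fun n ↦ Q n x) → UniformCauchySeqOn Q atTop (ball x ρ) :=
    fun hPc hx ↦ uniformCauchySeqOn_ball_of_deriv hPc (fun n w _ ↦ hQ n w) hx
  -- the set where `(Q n x)` converges is open and closed in `G`, hence all of `G`
  set S : Set ℂ := {x | x ∈ G ∧ CauchySeq fun n ↦ Q n x} with hSdef
  have hSG : G ⊆ S := by
    refine hGc.subset_of_closure_inter_subset (u := S) ?_ ⟨z₀, hz₀, hz₀, ?_⟩ ?_
    · rw [Metric.isOpen_iff]
      rintro x ⟨hxG, hx⟩
      obtain ⟨ρ, hρ, hρG, hPc⟩ := hdisc x hxG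
      exact ⟨ρ, hρ, fun y hy ↦ ⟨hρG hy, (hball hPc hx).cauchy_map hy⟩⟩
    · simp only [hQ₀]
      exact cauchySeq_const 0
    · rintro x ⟨hxc, hxG⟩
      obtain ⟨ρ, hρ, hρG, hPc⟩ := hdisc x hxG
      obtain ⟨y, ⟨-, hy⟩, hxy⟩ := Metric.mem_closure_iff.1 hxc (ρ / 2) (by positivity)
      -- re-centre at `y`: `ball y (ρ/2) ⊆ ball x ρ` and contains `x`
      have hsub : ball y (ρ / 2) ⊆ ball x ρ := fun w hw ↦ by
        rw [mem_ball] at hw ⊢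
        have := dist_triangle w y x
        rw [dist_comm x y] at hxy
        linarith
      have hU := hball (hPc.mono hsub) hy
      have hxy' : x ∈ ball y (ρ / 2) := mem_ball.2 hxy
      exact ⟨hxG, hU.cauchy_map hxy'⟩
  -- the limit `F`
  set F : ℂ → ℂ := fun z ↦ limUnder atTop fun n ↦ Q n z with hFdef
  have hFt : ∀ z ∈ G, Tendsto (fun n ↦ Q n z) atTop (𝓝 (F z)) := fun z hz ↦
    (hSG hz).2.tendsto_limUnder
  have hQF : TendstoLocallyUniformlyOn Q F atTop G := by
    refine Metric.tendstoLocallyUniformlyOn_iff.2 fun ε hε x hx ↦ ?_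
    obtain ⟨ρ, hρ, hρG, hPc⟩ := hdisc x hx
    have hT : TendstoUniformlyOn Q F atTop (ball x ρ) :=
      (hball hPc (hSG hx).2).tendstoUniformlyOn_of_tendsto fun y hy ↦ hFt y (hρG hy)
    exact ⟨ball x ρ, mem_nhdsWithin_of_mem_nhds (ball_mem_nhds x hρ),
      Metric.tendstoUniformlyOn_iff.1 hT ε hε⟩
  have hQd : ∀ᶠ n in atTop, DifferentiableOn ℂ (Q n) G :=
    Eventually.of_forall fun n z _ ↦ (hQ n z).differentiableAt.differentiableWithinAt
  have hFd : DifferentiableOn ℂ F G := hQF.differentiableOn hQd hG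
  refine ⟨F, fun z hz ↦ ?_⟩
  have h1 : Tendsto (fun n ↦ deriv (Q n) z) atTop (𝓝 (deriv F z)) :=
    (hQF.deriv hQd hG).tendsto_at hz
  have h2 : Tendsto (fun n ↦ deriv (Q n) z) atTop (𝓝 (f z)) := by
    have : (fun n ↦ deriv (Q n) z) = fun n ↦ P n z := funext fun n ↦ (hQ n z).deriv
    rw [this]
    exact hPf.tendsto_at hz
  rw [← tendsto_nhds_unique h1 h2]
  exact (hFd.differentiableAt (hG.mem_nhds hz)).hasDerivAt

/-- **Primitives on hole-free domains** (Conway VIII.2.2, (c) ⇒ (f)): if `G ⊆ ℂ` is open and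
connected and no component of `ℂ \ G` is bounded, every holomorphic `f` on `G` has a primitive on
`G` (`Complex.IsExactOn f G`). Conway, *Functions of One Complex Variable I* (1978), Thm. VIII.2.2.
[cite: Conway1978, Ch. VIII Thm. 2.2 ((c)⇒(f))] -/
theorem isExactOn_of_compl {G : Set ℂ} (hG : IsOpen G) (hGc : IsPreconnected G)
    (hGh : ∀ a ∈ Gᶜ, ¬ IsBounded (connectedComponentIn Gᶜ a)) {f : ℂ → ℂ}
    (hf : DifferentiableOn ℂ f G) : IsExactOn f G :=
  isExactOn_of_polynomial_approx hG hGc fun _ hKG hK _ hε ↦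
    exists_polynomial_norm_sub_lt_of_isOpen hG hGh hK hKG hf hε

/-! ### Logarithms and square roots (Conway VIII.2.2, (f) ⇒ (g) ⇒ (h)) -/

/-- **Holomorphic logarithms from primitives** (Conway VIII.2.2, (f) ⇒ (g); cf. Cor. IV.6.17).
Let `G` be open and connected such that every holomorphic function on `G` has a primitive. Then
every zero-free holomorphic `f` on `G` is `exp ∘ g` for some holomorphic `g`: take a primitive `F`
of `f'/f`, normalise `g = F - F(z₀) + log f(z₀)`; then `(f e^{-g})' = 0`, so `f e^{-g} ≡ 1`.
Conway, *Functions of One Complex Variable I* (1978), Thm. VIII.2.2. [cite: Conway1978, Ch. VIII Thm. 2.2 ((f)⇒(g))] -/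
theorem exists_eq_exp_of_forall_isExactOn {G : Set ℂ} (hG : IsOpen G) (hGc : IsPreconnected G)
    (hprim : ∀ f : ℂ → ℂ, DifferentiableOn ℂ f G → IsExactOn f G)
    {f : ℂ → ℂ} (hf : DifferentiableOn ℂ f G) (hf0 : ∀ z ∈ G, f z ≠ 0) :
    ∃ g : ℂ → ℂ, DifferentiableOn ℂ g G ∧ ∀ z ∈ G, f z = exp (g z) := by
  rcases G.eq_empty_or_nonempty with rfl | ⟨z₀, hz₀⟩
  · exact ⟨0, differentiableOn_const 0, fun z hz ↦ hz.elim⟩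
  -- a primitive of `f'/f`
  have hf' : DifferentiableOn ℂ (deriv f) G := (hf.analyticOnNhd hG).deriv.differentiableOn
  obtain ⟨F, hF⟩ := hprim (fun z ↦ deriv f z / f z) (hf'.div hf hf0)
  have hFd : DifferentiableOn ℂ F G := fun z hz ↦ (hF z hz).differentiableAt.differentiableWithinAt
  set g : ℂ → ℂ := fun z ↦ F z - F z₀ + log (f z₀) with hgdef
  have hgd : DifferentiableOn ℂ g G := (hFd.sub_const _).add_const _
  have hg : ∀ z ∈ G, HasDerivAt g (deriv f z / f z) z := fun z hz ↦ by
    simpa [hgdef] using ((hF z hz).sub_const (F z₀)).add_const (log (f z₀))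
  -- `h := f · exp (-g)` has zero derivative, hence is constant `= 1`
  set h : ℂ → ℂ := fun z ↦ f z * exp (-g z) with hhdef
  have hh : ∀ z ∈ G, HasDerivAt h 0 z := by
    intro z hz
    have hfz : HasDerivAt f (deriv f z) z := (hf.differentiableAt (hG.mem_nhds hz)).hasDerivAt
    have he : HasDerivAt (fun w ↦ exp (-g w)) (exp (-g z) * -(deriv f z / f z)) z :=
      (hg z hz).neg.cexp
    have key : deriv f z * exp (-g z) + f z * (exp (-g z) * -(deriv f z / f z)) = 0 := by
      have h1 : f z * (deriv f z / f z) = deriv f z := by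
        rw [← mul_div_assoc, mul_div_cancel_left₀ _ (hf0 z hz)]
      calc _ = deriv f z * exp (-g z) - exp (-g z) * (f z * (deriv f z / f z)) := by ring
        _ = 0 := by rw [h1]; ring
    have hmul : HasDerivAt (fun w ↦ f w * exp (-g w)) 0 z := (hfz.mul he).congr_deriv key
    rw [hhdef]
    exact hmul
  have hhd : DifferentiableOn ℂ h G := fun z hz ↦ (hh z hz).differentiableAt.differentiableWithinAt
  have hconst : ∀ z ∈ G, h z = h z₀ := fun z hz ↦
    hG.is_const_of_deriv_eq_zero hGc hhd (fun w hw ↦ (hh w hw).deriv) hz hz₀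
  have hh₀ : h z₀ = 1 := by
    simp only [hhdef, hgdef, sub_self, zero_add, exp_neg, exp_log (hf0 z₀ hz₀)]
    exact mul_inv_cancel₀ (hf0 z₀ hz₀)
  refine ⟨g, hgd, fun z hz ↦ ?_⟩
  have h1 : f z * exp (-g z) = 1 := by
    have := hconst z hz
    rw [hh₀] at this
    simpa [hhdef] using this
  calc f z = f z * exp (-g z) * exp (g z) := by
        rw [mul_assoc, ← exp_add, neg_add_cancel, exp_zero, mul_one]
    _ = exp (g z) := by rw [h1, one_mul]

/-- **Holomorphic square roots from logarithms** (Conway VIII.2.2, (g) ⇒ (h)): `√f = exp (g/2)`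
for `f = exp g`. [cite: Conway1978, Ch. VIII Thm. 2.2 ((g)⇒(h))] -/
theorem exists_sq_eq_of_exists_eq_exp {G : Set ℂ} {f : ℂ → ℂ}
    (h : ∃ g : ℂ → ℂ, DifferentiableOn ℂ g G ∧ ∀ z ∈ G, f z = exp (g z)) :
    ∃ h : ℂ → ℂ, DifferentiableOn ℂ h G ∧ ∀ z ∈ G, h z ^ 2 = f z := by
  obtain ⟨g, hgd, hg⟩ := h
  refine ⟨fun z ↦ exp (g z / 2), (hgd.div_const 2).cexp, fun z hz ↦ ?_⟩
  rw [hg z hz, sq, ← exp_add]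
  ring_nf

/-- **Square roots on hole-free domains** (Conway VIII.2.2, (c) ⇒ (h)): if `G ⊆ ℂ` is open and
connected and no component of `ℂ \ G` is bounded, then every zero-free holomorphic function on `G`
has a holomorphic square root on `G` (and a holomorphic logarithm,
`exists_eq_exp_of_forall_isExactOn`); the conclusion is the body of `Complex.HasSqrt G` of
`Literature.Analysis.Complex.RiemannMapping`. Conway, *Functions of One Complex Variable I* (1978),
Thm. VIII.2.2. [cite: Conway1978, Ch. VIII Thm. 2.2 ((c)⇒(h))] -/
theorem exists_sq_eq_of_compl {G : Set ℂ} (hG : IsOpen G) (hGc : IsPreconnected G)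
    (hGh : ∀ a ∈ Gᶜ, ¬ IsBounded (connectedComponentIn Gᶜ a)) {f : ℂ → ℂ}
    (hf : DifferentiableOn ℂ f G) (hf0 : ∀ z ∈ G, f z ≠ 0) :
    ∃ h : ℂ → ℂ, DifferentiableOn ℂ h G ∧ ∀ z ∈ G, h z ^ 2 = f z :=
  exists_sq_eq_of_exists_eq_exp (exists_eq_exp_of_forall_isExactOn hG hGc
    (fun _ hf' ↦ isExactOn_of_compl hG hGc hGh hf') hf hf0)

end Complex

end
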